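import Literature.Computability.AlgebraicComplexity.KV20CoefficientQueryFP
import Literature.Computability.Complexity.SuccinctKernelVectorGates
import HarnessLib

/-!
# Kumar–Volk 2020/2022, Cor 1.3 (M1 programme, step (P6b), data half): the evaluation matrix of
# the canonical Kumar–Volk system as a `SuccIntMatrixFamily`

Source: M. Kumar, B. L. Volk, *A polynomial degree bound on equations for non-rigid matrices and
small linear circuits*, ACM TOCT 14(2) (2022) art. 6 = arXiv:2003.12938 [KumarVolk2022], §6 (= arXiv
§5), proof of Cor 1.3: "the coefficients of `Q_n` … by solving a linear system of equations of
dimension `exp(poly(n))` whose entries are computable in polynomial time … standard small-space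
linear algebra". In the val-lit cell's reduction of record the system is the EXPLICIT integer matrix
`A = evalMat (uFinFlat n) (n^3) (kvGridBound n)` (x5, `KV20CanonicalEquation.lean`), its entries are
the polynomial-time function `UEval.kvEntry` with the bit width `UEval.kvEntryWidth`
(t21 g11, `KV20EvaluationMatrixFP.lean`), and the succinct kernel-vector circuit of
`Complexity/SuccinctKernelVectorGates.lean` (x5 g7) is PARAMETRISED by a
`SuccIntMatrixFamily` — rows `R n`, columns `N n`, entry width `W₀ n`, a unary field width `F n`
with `R n, N n < 2^{F n}`, the entries `A n r c`, and polynomial-time codes of all five.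

This file packages the canonical system as that parameter (pure DATA; no circuit is built here):

* `kvRows n = (kvGridBound n + 1)^(s+s)`, `kvCols n = (n^3+1)^(n·n)` (`s = corSize n`) — by
  construction DEFINITIONALLY the index types of `evalMat (uFinFlat n) (n^3) (kvGridBound n)`;
  `kvCols_pos`, `kvRows_pos`;
* `kvFieldWidth n = (s+s)·(kvGridBound n + 1) + n·n·(n^3+1) + 1` (an explicit arithmetic
  expression) with `kvRows_lt_two_pow`, `kvCols_lt_two_pow`;
* the codes `kvRowsFP`, `kvColsFP : CodeFP unE natE _`, `kvFieldWidthFP : CodeFP unE unE _`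
  (typed combinators only, from `UEval.kvGridBoundFP` / `UEval.corSizeUFP`);
* ★ `kvMatrixFamily : SuccIntMatrixFamily` — `R = kvRows`, `N = kvCols`, `W₀ = UEval.kvEntryWidth`,
  `F = kvFieldWidth`, `A = UEval.kvEntry`, with `natAbs_lt := UEval.natAbs_kvEntry_lt_two_pow` and
  `A_fp := UEval.kvEntryFP`; the `@[simp]` projections `kvMatrixFamily_R/…/_A`;
* `kvMatrixFamily_entry` : on its index ranges the entry IS `evalMat (uFinFlat n) (n^3) (kvGridBound n) r c`
  (`UEval.kvEntry_of_lt`), and `kvAmat n` = that matrix read through the family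
  (`kvAmat_eq_evalMat`), so that the circuit's output `charpolyKernelVector ((kvAmat n)ᵀ * kvAmat n)`
  is LITERALLY the coefficient vector of `kvCanonicalEquation n` (`coeff_kvCanonicalEquation_eq_kvAmat`,
  from x5's `coeff_kvCanonicalEquation`); `kvGram_eq_kvAmat`, `kvKernelEntry_eq_kvAmat` (t21 g11's
  normal form `UEval.kvGram` / `UEval.kvKernelEntry` read through the family) and
  ★ `kernelEntry_of_gateValues` — the hypothesis `hAB` of the closer form
  `UEval.kumarVolk2020_cor_1_3_of_gates` from ANY pair of ℕ-valued gate families whose difference is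
  the circuit's kernel vector of `(kvAmat n)ᵀ * kvAmat n` (the shape the values file proves).

Plumbing `def`s only; 0 named facts; census +0. HONEST FRAMING (val-lit, KV20 M1 programme, RULING
(120)): data packaging for the machine side of a published CONDITIONAL result's reduction;
`kumarVolk2020_cor_1_3` stays OPEN by name (its hypothesis
`coeffBitLanguage kvCanonicalFamily ∈ PSPACE` is untouched here); `VP ≠ VNP` is NOT proved and
nothing in this file bears on it.

## References

* [KumarVolk2022] M. Kumar, B. L. Volk, ACM TOCT 14(2) (2022) art. 6 = arXiv:2003.12938, §6 /
  arXiv §5 p0009:L1–3 (proof of Cor 1.3).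
* [AroraBarak2009] S. Arora, B. Barak, *Computational Complexity: A Modern Approach*, CUP 2009,
  §1.3 (polynomial time: composition), §6.8 Def. 6.30 (succinct representations).
-/

noncomputable section

namespace Literature.Computability.AlgebraicComplexity

namespace KumarVolk2020

open MvPolynomial Finset Matrix Literature.Computability.Complexity CodeFP

/-! ### §1. The dimensions and the field width -/

/-- Number of ROWS of the canonical system: grid points `z ∈ {0,…,D}^{2s}`, `D = kvGridBound n`,
`s = corSize n`. [cite: KumarVolk2022, §6 (proof of Cor 1.3)] -/
def kvRows (n : ℕ) : ℕ := (kvGridBound n + 1) ^ (corSize n + corSize n)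

/-- Number of COLUMNS of the canonical system: exponent vectors `α ∈ {0,…,n³}^{n²}`.
[cite: KumarVolk2022, §6 (proof of Cor 1.3)] -/
def kvCols (n : ℕ) : ℕ := (n ^ 3 + 1) ^ (n * n)

/-- The FIELD WIDTH of the names: `F(n) = 2s·(D+1) + n²·(n³+1) + 1` (unary-sized, `poly(n)`).
[cite: AroraBarak2009, §6.8 Def. 6.30] -/
def kvFieldWidth (n : ℕ) : ℕ :=
  (corSize n + corSize n) * (kvGridBound n + 1) + n * n * (n ^ 3 + 1) + 1

/-- `kvRows n` is the row count of `evalMat (uFinFlat n) (n^3) (kvGridBound n)` (definitionally).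
[cite: KumarVolk2022, §6 (proof of Cor 1.3)] -/
theorem kvRows_eq (n : ℕ) : kvRows n = (kvGridBound n + 1) ^ (corSize n + corSize n) := rfl

/-- `kvCols n` is the column count of `evalMat (uFinFlat n) (n^3) (kvGridBound n)` (definitionally).
[cite: KumarVolk2022, §6 (proof of Cor 1.3)] -/
theorem kvCols_eq (n : ℕ) : kvCols n = (n ^ 3 + 1) ^ (n * n) := rfl

/-- There is at least one row. [cite: KumarVolk2022, §6 (proof of Cor 1.3)] -/
theorem kvRows_pos (n : ℕ) : 0 < kvRows n := pow_pos (Nat.succ_pos _) _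

/-- There is at least one column (the circuit needs `0 < N n`). [cite: KumarVolk2022, §6 (proof of Cor 1.3)] -/
theorem kvCols_pos (n : ℕ) : 0 < kvCols n := pow_pos (Nat.succ_pos _) _

/-- For `n ≥ 1` there are at least two columns (the circuit's `2 ≤ N n` side condition; at
`n = 0` the system is `1 × 1` and `Q_0 = 0` is handled apart). [cite: KumarVolk2022, §6 (proof of Cor 1.3)] -/
theorem two_le_kvCols {n : ℕ} (hn : 1 ≤ n) : 2 ≤ kvCols n := by
  unfold kvCols
  have h1 : 2 ≤ n ^ 3 + 1 := by
    have : 1 ≤ n ^ 3 := Nat.one_le_pow _ _ hn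
    omega
  calc 2 ≤ n ^ 3 + 1 := h1
    _ = (n ^ 3 + 1) ^ 1 := (pow_one _).symm
    _ ≤ (n ^ 3 + 1) ^ (n * n) := Nat.pow_le_pow_right (by omega) (Nat.one_le_iff_ne_zero.2 (by positivity))

/-- `b^k < 2^(k·b + 1)` (from `b < 2^b`). [folklore] -/
private theorem pow_lt_two_pow_mul_succ (b k : ℕ) : b ^ k < 2 ^ (k * b + 1) := by
  have h1 : b ^ k ≤ (2 ^ b) ^ k := Nat.pow_le_pow_left (Nat.lt_two_pow_self).le k
  calc b ^ k ≤ (2 ^ b) ^ k := h1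
    _ = 2 ^ (k * b) := by rw [← pow_mul, mul_comm]
    _ < 2 ^ (k * b + 1) := Nat.pow_lt_pow_right (by norm_num) (Nat.lt_succ_self _)

/-- `R n < 2^{F n}`. [cite: AroraBarak2009, §6.8 Def. 6.30] -/
theorem kvRows_lt_two_pow (n : ℕ) : kvRows n < 2 ^ kvFieldWidth n := by
  refine lt_of_lt_of_le (pow_lt_two_pow_mul_succ _ _) (Nat.pow_le_pow_right (by norm_num) ?_)
  unfold kvFieldWidth
  omega

/-- `N n < 2^{F n}`. [cite: AroraBarak2009, §6.8 Def. 6.30] -/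
theorem kvCols_lt_two_pow (n : ℕ) : kvCols n < 2 ^ kvFieldWidth n := by
  refine lt_of_lt_of_le (pow_lt_two_pow_mul_succ _ _) (Nat.pow_le_pow_right (by norm_num) ?_)
  unfold kvFieldWidth
  nlinarith [Nat.zero_le ((corSize n + corSize n) * (kvGridBound n + 1)), Nat.zero_le (n * n * (n ^ 3 + 1))]

/-! ### §2. The codes (typed combinators only) -/

section Codes

variable {T : Type} {eT : T → List Bool} {nf : T → ℕ}

/-- Unary product. [cite: AroraBarak2009, §1.3] -/
private theorem unMul₀ {f g : T → ℕ} (hf : CodeFP eT unE f) (hg : CodeFP eT unE g) :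
    CodeFP eT unE (fun t => f t * g t) :=
  ((ulength unitE).comp (unitsMul.comp ((replicateUnit.comp hf).pair (replicateUnit.comp hg)))).congr
    fun p => by simp

/-- A unary numeral read in binary. [folklore] -/
private theorem natOfUn₀ {f : T → ℕ} (h : CodeFP eT unE f) : CodeFP eT natE f :=
  (natOfUn.comp h).congr fun _ => rfl

/-- **`R` on codes** (binary, from `1ⁿ`). [cite: AroraBarak2009, §1.3] -/
theorem kvRowsFP' (hn : CodeFP eT unE nf) : CodeFP eT natE (fun t => kvRows (nf t)) := by
  have hs := UEval.corSizeUFP hn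
  have hss : CodeFP eT unE (fun t => corSize (nf t) + corSize (nf t)) := (unAdd.comp (hs.pair hs) :)
  have hD1 : CodeFP eT natE (fun t => kvGridBound (nf t) + 1) :=
    (natAdd.comp ((UEval.kvGridBoundFP hn).pair (const _ (1 : ℕ))) :)
  exact ((natPow.comp (hD1.pair hss))).congr fun _ => rfl

/-- **`N` on codes** (binary, from `1ⁿ`). [cite: AroraBarak2009, §1.3] -/
theorem kvColsFP' (hn : CodeFP eT unE nf) : CodeFP eT natE (fun t => kvCols (nf t)) := by
  have hnN := natOfUn₀ hn
  have hnn : CodeFP eT unE (fun t => nf t * nf t) := unMul₀ hn hn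
  have hb : CodeFP eT natE (fun t => nf t ^ 3 + 1) :=
    (natAdd.comp ((natPow.comp (hnN.pair (const _ (3 : ℕ)))).pair (const _ (1 : ℕ))) :)
  exact ((natPow.comp (hb.pair hnn))).congr fun _ => rfl

/-- `D = kvGridBound n` in UNARY (it is `poly(n)`: built from unary pieces).
[cite: KumarVolk2022, §6 (proof of Cor 1.3)] -/
theorem kvGridBoundUFP (hn : CodeFP eT unE nf) : CodeFP eT unE (fun t => kvGridBound (nf t)) := by
  have hs := UEval.corSizeUFP hn
  have hS : CodeFP eT unE (fun t => UEval.nS (nf t) (corSize (nf t))) :=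
    (unAdd.comp ((unMul₀ hs hn).pair (unAdd.comp ((unMul₀ hs hs).pair
      (unMul₀ hn (unAdd.comp (hn.pair hs))))))).congr fun _ => rfl
  have h3 : CodeFP eT unE (fun t => nf t ^ 3) :=
    (unMul₀ (unMul₀ hn hn) hn).congr fun t => by simp only [pow_succ, pow_zero, one_mul]
  have hs1 : CodeFP eT unE (fun t => corSize (nf t) + 1) := (unAdd.comp (hs.pair (const _ (1 : ℕ))) :)
  exact ((unMul₀ (unMul₀ (unMul₀ hn hn) h3) (unMul₀ hS hs1))).congr fun t => by
    simp only [kvGridBound, ← UEval.nS_eq_card]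

/-- **`F` on codes** (UNARY, from `1ⁿ`). [cite: AroraBarak2009, §1.3] -/
theorem kvFieldWidthFP' (hn : CodeFP eT unE nf) : CodeFP eT unE (fun t => kvFieldWidth (nf t)) := by
  have hs := UEval.corSizeUFP hn
  have hss : CodeFP eT unE (fun t => corSize (nf t) + corSize (nf t)) := (unAdd.comp (hs.pair hs) :)
  have hD1 : CodeFP eT unE (fun t => kvGridBound (nf t) + 1) :=
    (unAdd.comp ((kvGridBoundUFP hn).pair (const _ (1 : ℕ))) :)
  have hnn : CodeFP eT unE (fun t => nf t * nf t) := unMul₀ hn hn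
  have h3 : CodeFP eT unE (fun t => nf t ^ 3) :=
    (unMul₀ (unMul₀ hn hn) hn).congr fun t => by simp only [pow_succ, pow_zero, one_mul]
  have hb : CodeFP eT unE (fun t => nf t ^ 3 + 1) := (unAdd.comp (h3.pair (const _ (1 : ℕ))) :)
  exact ((unAdd.comp ((unAdd.comp ((unMul₀ hss hD1).pair (unMul₀ hnn hb))).pair
    (const _ (1 : ℕ))))).congr fun _ => rfl

end Codes

/-- `R` from `1ⁿ`. [cite: AroraBarak2009, §1.3] -/
theorem kvRowsFP : CodeFP unE natE kvRows := (kvRowsFP' (CodeFP.id unE)).congr fun _ => rfl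

/-- `N` from `1ⁿ`. [cite: AroraBarak2009, §1.3] -/
theorem kvColsFP : CodeFP unE natE kvCols := (kvColsFP' (CodeFP.id unE)).congr fun _ => rfl

/-- `F` from `1ⁿ`, in unary. [cite: AroraBarak2009, §1.3] -/
theorem kvFieldWidthFP : CodeFP unE unE kvFieldWidth :=
  (kvFieldWidthFP' (CodeFP.id unE)).congr fun _ => rfl

/-! ### §3. The family -/

/-- ★ **The canonical Kumar–Volk system as a polynomial-time integer matrix family** (the parameter
of the succinct kernel-vector circuit): rows `kvRows`, columns `kvCols`, entries `UEval.kvEntry`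
(`= evalMat (uFinFlat n) (n^3) (kvGridBound n)` on range), entry width `UEval.kvEntryWidth`, field
width `kvFieldWidth`. [cite: KumarVolk2022, §6 (proof of Cor 1.3)] [cite: AroraBarak2009, §6.8 Def. 6.30] -/
def kvMatrixFamily : SuccIntMatrixFamily where
  R := kvRows
  N := kvCols
  W₀ := UEval.kvEntryWidth
  F := kvFieldWidth
  A := UEval.kvEntry
  natAbs_lt := UEval.natAbs_kvEntry_lt_two_pow
  R_lt := kvRows_lt_two_pow
  N_lt := kvCols_lt_two_pow
  R_fp := kvRowsFP
  N_fp := kvColsFP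
  W₀_fp := UEval.kvEntryWidthFP_un
  F_fp := kvFieldWidthFP
  A_fp := UEval.kvEntryFP

/-- The rows of the family are `kvRows` (definitionally). [cite: KumarVolk2022, §6 (proof of Cor 1.3)] -/
@[simp] theorem kvMatrixFamily_R : kvMatrixFamily.R = kvRows := rfl

/-- The columns of the family are `kvCols` (definitionally). [cite: KumarVolk2022, §6 (proof of Cor 1.3)] -/
@[simp] theorem kvMatrixFamily_N : kvMatrixFamily.N = kvCols := rfl

/-- The entry width of the family is `UEval.kvEntryWidth` (definitionally). [cite: KumarVolk2022, §6 (proof of Cor 1.3)] -/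
@[simp] theorem kvMatrixFamily_W₀ : kvMatrixFamily.W₀ = UEval.kvEntryWidth := rfl

/-- The field width of the family is `kvFieldWidth` (definitionally). [cite: AroraBarak2009, §6.8 Def. 6.30] -/
@[simp] theorem kvMatrixFamily_F : kvMatrixFamily.F = kvFieldWidth := rfl

/-- The entries of the family are `UEval.kvEntry` (definitionally). [cite: KumarVolk2022, §6 (proof of Cor 1.3)] -/
@[simp] theorem kvMatrixFamily_A : kvMatrixFamily.A = UEval.kvEntry := rfl

/-- `0 < N n` for the canonical family (a side condition of the circuit's well-formedness).
[cite: KumarVolk2022, §6 (proof of Cor 1.3)] -/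
theorem kvMatrixFamily_N_pos (n : ℕ) : 0 < kvMatrixFamily.N n := kvCols_pos n

/-! ### §4. The family's matrix IS the evaluation matrix -/

/-- The `n`-th matrix of the family on its index types. [cite: KumarVolk2022, §6 (proof of Cor 1.3)] -/
def kvAmat (n : ℕ) : Matrix (Fin (kvRows n)) (Fin (kvCols n)) ℤ :=
  Matrix.of fun r c => UEval.kvEntry n r c

/-- On range the family's entry is the entry of `evalMat (uFinFlat n) (n^3) (kvGridBound n)`.
[cite: KumarVolk2022, §6 (proof of Cor 1.3)] -/
theorem kvMatrixFamily_entry (n : ℕ) (r : Fin (kvRows n)) (c : Fin (kvCols n)) :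
    kvMatrixFamily.A n r c = evalMat (uFinFlat n) (n ^ 3) (kvGridBound n) r c :=
  UEval.kvEntry_of_lt n r c

/-- ★ `kvAmat n = evalMat (uFinFlat n) (n^3) (kvGridBound n)` (same index types, definitionally).
[cite: KumarVolk2022, §6 (proof of Cor 1.3)] -/
theorem kvAmat_eq_evalMat (n : ℕ) : kvAmat n = evalMat (uFinFlat n) (n ^ 3) (kvGridBound n) := by
  ext r c
  exact UEval.kvEntry_of_lt n r c

/-- ★ **The coefficients of `Q_n` are the entries of the kernel vector of the family's Gram matrix**:
`coeff d (kvCanonicalEquation n) = charpolyKernelVector ((kvAmat n)ᵀ * kvAmat n) c` at the column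
`c` coding `d` (exponents `≤ n³`), and `0` at exponent vectors outside the box.
[cite: KumarVolk2022, §6 (proof of Cor 1.3, "outputs the list of coefficients of Q_n")] -/
theorem coeff_kvCanonicalEquation_eq_kvAmat (n : ℕ) (d : Fin (n * n) →₀ ℕ) :
    coeff d (kvCanonicalEquation n) =
      if h : ∀ i, d i ≤ n ^ 3 then
        Literature.LinearAlgebra.charpolyKernelVector ((kvAmat n)ᵀ * kvAmat n)
          (finFunctionFinEquiv fun i => ⟨d i, Nat.lt_succ_of_le (h i)⟩)
      else 0 := by
  rw [kvAmat_eq_evalMat]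
  exact coeff_kvCanonicalEquation n d

/-! ### §5. Reading t21 g11's normal form through the family (the closer's hypothesis `hAB`) -/

/-- The Gram matrix of the normal form IS `(kvAmat n)ᵀ * kvAmat n`. [cite: KumarVolk2022, §6 (proof of Cor 1.3)] -/
theorem kvGram_eq_kvAmat (n : ℕ) : UEval.kvGram n = (kvAmat n)ᵀ * kvAmat n :=
  UEval.kvGram_eq_of_kvEntry n

/-- The kernel-entry function of the normal form IS the kernel vector of `(kvAmat n)ᵀ * kvAmat n` on
the column range. [cite: KumarVolk2022, §6 (proof of Cor 1.3)] -/
theorem kvKernelEntry_eq_kvAmat (n : ℕ) (c : Fin (kvCols n)) :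
    UEval.kvKernelEntry n c =
      Literature.LinearAlgebra.charpolyKernelVector ((kvAmat n)ᵀ * kvAmat n) c := by
  rw [UEval.kvKernelEntry_of_lt, kvGram_eq_kvAmat]
  rfl

/-- ★ **From gate values to the closer's hypothesis.** If two ℕ-valued families `A⁺ n c`, `A⁻ n c`
(the values of the designated output gates of the succinct kernel-vector circuit run on
`kvMatrixFamily`) differ by the kernel vector of `(kvAmat n)ᵀ * kvAmat n` at every column `c` for
`n ≥ 1`, then they satisfy the hypothesis `hAB` of `UEval.kumarVolk2020_cor_1_3_of_gates` /
`UEval.coeffBitLanguage_kvCanonicalFamily_mem_PSPACE_of_gates`. [cite: KumarVolk2022, §6 (proof of Cor 1.3)] -/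
theorem kernelEntry_of_gateValues {Ap Am : ℕ → ℕ → ℕ}
    (hval : ∀ n : ℕ, 1 ≤ n → ∀ c : Fin (kvCols n),
      (Ap n c : ℤ) - Am n c = Literature.LinearAlgebra.charpolyKernelVector ((kvAmat n)ᵀ * kvAmat n) c) :
    ∀ n c : ℕ, 1 ≤ n → c < (n ^ 3 + 1) ^ (n * n) → (Ap n c : ℤ) - Am n c = UEval.kvKernelEntry n c := by
  intro n c hn hc
  rw [show c = ((⟨c, hc⟩ : Fin (kvCols n)) : ℕ) from rfl, hval n hn ⟨c, hc⟩, kvKernelEntry_eq_kvAmat]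

end KumarVolk2020

end Literature.Computability.AlgebraicComplexity

end
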